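import Summits.CriticalPhenomena.SAWScalingLimit.Theorems.SAWRestrictionRigidityLimitExistsObservablewise
import Mathlib.MeasureTheory.Measure.HasOuterApproxClosed
import HarnessLib

/-!
# `LimitExists` (crux stmt-CriticalPhenomena-1371) — modulo tightness, COUNTABLY many real limits

Route `SAWRestrictionRigidity` of `CriticalPhenomena/SAWScalingLimit`; line `registered`
(`Cruxes/LimitExists/Lines/birth.lean`), lead c4.

`limitExists_iff_eventualTight_and_forall_tendsto_integral` (p152394) reads the crux as eventual tightness (T)
plus the convergence of `E_δ[f(γ)]` along `δ → 0⁺` for EVERY bounded continuous observable `f` of the curve class,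
and `limitExists_iff_forall_tendsto_integral` (p154556) shows that with ALL observables (T) is automatic.  Here
the observable side is cut down to where it cannot hide tightness any more:

* **`exists_countable_separating_integral`** — on a second-countable pseudo-metric Borel space there is a
  COUNTABLE set of bounded continuous real observables whose integrals separate finite Borel measures
  (complements of finite unions of basic open sets form a countable closed π-system generating the Borel
  σ-algebra; Mathlib's `IsClosed.apprSeq` recovers their masses; the constant `1` recovers the total mass);
* **`limitExists_iff_eventualTight_and_forall_mem_tendsto_integral`** — for ANY separating class `F`:
  `LimitExists ↔ EventualTight ∧` (for every Dobrushin domain, every endpoint approximation and every `f ∈ F`,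
  `E_δ[f(γ)]` converges along `δ → 0⁺` to some real number);
* **`limitExists_iff_eventualTight_and_countable`** — hence ONE countable separating `F` for which the same
  equivalence holds: modulo (T) = item stmt-CriticalPhenomena-1372 the crux is the convergence of countably many
  real sequences `δ ↦ E_δ[f(γ)]`, `f ∈ F`, per domain and approximation.  (Without (T) no countable family
  suffices — mass may escape along a diagonal subsequence — so this is the exact split of the crux into its
  compactness half and a countable numerical half.)

Everything proved, standard axioms. [folklore; Parthasarathy, *Probability measures on metric spaces*, Thm. II.6.6;
Billingsley CPM Thm. 1.2 and Thm. 2.6]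
-/

noncomputable section

open MeasureTheory Filter Topology Set Metric Function TopologicalSpace
open Literature.Probability.RandomPlanarGeometry Literature.Probability.RandomPlanarGeometry.SAW
open Literature.Probability.LatticeModels
open scoped ENNReal NNReal BoundedContinuousFunction Topology

namespace Summit.CriticalPhenomena.SAWScalingLimit.Theorems.SAWRestrictionRigidityLimitExists

open Summit.CriticalPhenomena.SAWScalingLimit.Theses.SAWRestrictionRigidity (LimitExists EventualTight)

/-- **A countable separating family of bounded continuous observables.**  On a second-countable pseudo-metric
space with its Borel σ-algebra there is a countable set `F` of bounded continuous real functions such that two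
finite Borel measures with equal integrals of every member of `F` are equal.  Construction: fix a countable
topological basis `B`; the complements of finite unions of members of `B` form a countable π-system of closed sets
generating the Borel σ-algebra; for each of them the approximating sequence `IsClosed.apprSeq` (thickened
indicators) consists of countably many observables whose integrals recover the mass of the set
(`HasOuterApproxClosed.tendsto_lintegral_apprSeq`), and the constant observable `1` recovers the total mass; conclude
with `MeasureTheory.ext_of_generate_finite`. [folklore; Parthasarathy, Probability measures on metric spaces,
Thm. II.6.6] -/
theorem exists_countable_separating_integral (X : Type*) [PseudoMetricSpace X] [SecondCountableTopology X]
    [MeasurableSpace X] [BorelSpace X] :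
    ∃ F : Set (X →ᵇ ℝ), F.Countable ∧ ∀ (μ ν : Measure X), IsFiniteMeasure μ → IsFiniteMeasure ν →
      (∀ f ∈ F, ∫ x, f x ∂μ = ∫ x, f x ∂ν) → μ = ν := by
  classical
  obtain ⟨B, hBc, -, hB⟩ := TopologicalSpace.exists_countable_basis X
  -- the closed π-system: complements of finite unions of basic open sets
  obtain ⟨C, hCdef⟩ : ∃ C : Set (Set X), C = (fun T : Set (Set X) => (⋃₀ T)ᶜ) '' {T | T.Finite ∧ T ⊆ B} :=
    ⟨_, rfl⟩
  have hCc : C.Countable := by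
    rw [hCdef]
    exact (Set.countable_setOf_finite_subset hBc).image _
  have hCclosed : ∀ s ∈ C, IsClosed s := by
    intro s hs
    rw [hCdef] at hs
    obtain ⟨T, ⟨-, hTB⟩, rfl⟩ := hs
    exact (isOpen_sUnion fun t ht => hB.isOpen (hTB ht)).isClosed_compl
  have hCpi : IsPiSystem C := by
    intro s hs t ht _
    rw [hCdef] at hs ht ⊢
    obtain ⟨T, ⟨hTf, hTB⟩, rfl⟩ := hs
    obtain ⟨T', ⟨hT'f, hT'B⟩, rfl⟩ := ht
    exact ⟨T ∪ T', ⟨hTf.union hT'f, Set.union_subset hTB hT'B⟩,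
      by simp only [Set.sUnion_union, Set.compl_union]⟩
  have hgen : ‹MeasurableSpace X› = MeasurableSpace.generateFrom C := by
    refine le_antisymm ?_ (MeasurableSpace.generateFrom_le fun s hs => (hCclosed s hs).measurableSet)
    rw [BorelSpace.measurable_eq (α := X), hB.borel_eq_generateFrom]
    refine MeasurableSpace.generateFrom_le fun U hU => ?_
    have hUc : Uᶜ ∈ C := by
      rw [hCdef]
      exact ⟨{U}, ⟨Set.finite_singleton U, Set.singleton_subset_iff.2 hU⟩,
        by simp only [Set.sUnion_singleton]⟩
    simpa only [compl_compl] using (MeasurableSpace.measurableSet_generateFrom hUc).compl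
  -- the observables: real versions of the approximating sequences of the closures, and the constant `1`
  have hL : LipschitzWith 1 ((↑) : ℝ≥0 → ℝ) := LipschitzWith.of_dist_le_mul fun a b => by
    rw [NNReal.coe_one, one_mul, NNReal.dist_eq, Real.dist_eq]
  obtain ⟨obs, hobs⟩ : ∃ obs : Set X × ℕ → (X →ᵇ ℝ),
      ∀ p x, obs p x = (((isClosed_closure (s := p.1)).apprSeq p.2 x : ℝ≥0) : ℝ) :=
    ⟨fun p => BoundedContinuousFunction.comp ((↑) : ℝ≥0 → ℝ) hL ((isClosed_closure (s := p.1)).apprSeq p.2),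
      fun _ _ => rfl⟩
  refine ⟨insert 1 (obs '' (C ×ˢ Set.univ)), ((hCc.prod Set.countable_univ).image obs).insert 1, ?_⟩
  intro μ ν hμ hν hF
  -- equal total mass from the constant observable
  have huniv : μ Set.univ = ν Set.univ := by
    have h1 := hF 1 (Set.mem_insert _ _)
    simp only [BoundedContinuousFunction.coe_one, Pi.one_apply, integral_const, smul_eq_mul, mul_one,
      measureReal_def] at h1
    exact (ENNReal.toReal_eq_toReal_iff' (measure_ne_top μ _) (measure_ne_top ν _)).1 h1
  -- equal masses on the closed π-system from the approximating observables
  have key : ∀ s ∈ C, μ s = ν s := by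
    intro s hs
    have hcl : closure s = s := (hCclosed s hs).closure_eq
    have h1 := HasOuterApproxClosed.tendsto_lintegral_apprSeq (isClosed_closure (s := s)) μ
    have h2 := HasOuterApproxClosed.tendsto_lintegral_apprSeq (isClosed_closure (s := s)) ν
    have h3 : ∀ n, ∫⁻ x, ((isClosed_closure (s := s)).apprSeq n x : ℝ≥0∞) ∂μ =
        ∫⁻ x, ((isClosed_closure (s := s)).apprSeq n x : ℝ≥0∞) ∂ν := by
      intro n
      apply (ENNReal.toReal_eq_toReal_iff' (BoundedContinuousFunction.lintegral_lt_top_of_nnreal μ _).ne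
        (BoundedContinuousFunction.lintegral_lt_top_of_nnreal ν _).ne).mp
      rw [BoundedContinuousFunction.toReal_lintegral_coe_eq_integral,
        BoundedContinuousFunction.toReal_lintegral_coe_eq_integral]
      have h4 := hF (obs (s, n)) (Set.mem_insert_of_mem _ ⟨(s, n), ⟨hs, Set.mem_univ _⟩, rfl⟩)
      simp only [hobs] at h4
      exact h4
    have h5 : μ (closure s) = ν (closure s) := by
      simp_rw [h3] at h1
      exact tendsto_nhds_unique h1 h2
    rwa [hcl] at h5
  exact ext_of_generate_finite C hgen hCpi key huniv

variable {D : DobrushinDomain}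

/-- **Observable-wise limits on a separating class pin subsequential limits.**  Let `F` be a class of bounded
continuous observables separating finite Borel measures on the curve space.  If along every endpoint
approximation of `D` every `f ∈ F` has a limit of `E_δ[f(γ)]` along `δ → 0⁺`, then two probability weak limits
`ν, ν'` of the pushed critical SAW laws along two endpoint approximations and two mesh sequences `s, s' → 0⁺`
are equal: for `f ∈ F`, `∫ f dν` and `∫ f dν'` are the observable-wise limits along `(a, b)` and `(a', b')`
(limits in `ℝ` are unique), which agree by interleaving (`observableLimit_eq`, p152394); then `F` separates.
[folklore; Billingsley CPM Thm. 2.6] -/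
theorem eq_of_subseqLimits_of_observableLimits_on {F : Set (CurveClass ℂ →ᵇ ℝ)}
    (hF : ∀ μ ν : Measure (CurveClass ℂ), IsFiniteMeasure μ → IsFiniteMeasure ν →
      (∀ f ∈ F, ∫ x, f x ∂μ = ∫ x, f x ∂ν) → μ = ν)
    (hall : ∀ a'' b'' : ℝ → Site 2, IsEndpointApprox D a'' b'' → ∀ f ∈ F, ∃ L : ℝ,
      Tendsto (fun δ => ∫ γ, f γ.curve ∂(law D.carrier δ (a'' δ) (b'' δ))) (𝓝[>] (0 : ℝ)) (𝓝 L))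
    {a b a' b' : ℝ → Site 2} (hab : IsEndpointApprox D a b) (hab' : IsEndpointApprox D a' b')
    {s s' : ℕ → ℝ} {ν ν' : Measure (CurveClass ℂ)}
    (hs : Tendsto s atTop (𝓝[>] (0 : ℝ))) (hs' : Tendsto s' atTop (𝓝[>] (0 : ℝ)))
    [IsProbabilityMeasure ν] [IsProbabilityMeasure ν']
    (hlim : ∀ f : CurveClass ℂ →ᵇ ℝ, Tendsto (fun n => ∫ γ, f γ.curve
      ∂(law D.carrier (s n) (a (s n)) (b (s n)))) atTop (𝓝 (∫ x, f x ∂ν)))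
    (hlim' : ∀ f : CurveClass ℂ →ᵇ ℝ, Tendsto (fun n => ∫ γ, f γ.curve
      ∂(law D.carrier (s' n) (a' (s' n)) (b' (s' n)))) atTop (𝓝 (∫ x, f x ∂ν'))) : ν = ν' := by
  refine hF ν ν' inferInstance inferInstance fun f hf => ?_
  obtain ⟨c, hc⟩ := hall a b hab f hf
  obtain ⟨c', hc'⟩ := hall a' b' hab' f hf
  have h₁ : ∫ x, f x ∂ν = c := tendsto_nhds_unique (hlim f) (hc.comp hs)
  have h₂ : ∫ x, f x ∂ν' = c' := tendsto_nhds_unique (hlim' f) (hc'.comp hs')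
  rw [h₁, h₂]
  exact observableLimit_eq (fun a'' b'' h'' => hall a'' b'' h'' f hf) hab hab' hc hc'

/-- **`LimitExists ↔ EventualTight ∧ (observable-wise convergence on a separating class)`.**  For ANY class
`F` of bounded continuous observables separating finite Borel measures on the curve space: the critical `δℤ²`
SAW laws have a full scaling limit as a chordal curve family IF AND ONLY IF they are eventually tight (item
stmt-CriticalPhenomena-1372) AND for every Dobrushin domain, every endpoint approximation and every `f ∈ F` the
expectations `E_δ[f(γ)]` converge along `δ → 0⁺` to some real number.  Forward: the case `F = everything`
(`limitExists_iff_eventualTight_and_forall_tendsto_integral`, p152394); backward: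
`limitExists_iff_eventualTight_and_uniqueSubseqLimits` (p149315) with uniqueness of probability subsequential
limits from `eq_of_subseqLimits_of_observableLimits_on`. [folklore; Billingsley CPM Thm. 2.6] -/
theorem limitExists_iff_eventualTight_and_forall_mem_tendsto_integral {F : Set (CurveClass ℂ →ᵇ ℝ)}
    (hF : ∀ μ ν : Measure (CurveClass ℂ), IsFiniteMeasure μ → IsFiniteMeasure ν →
      (∀ f ∈ F, ∫ x, f x ∂μ = ∫ x, f x ∂ν) → μ = ν) :
    LimitExists ↔ (EventualTight ∧ ∀ (D : DobrushinDomain) (a b : ℝ → Site 2), IsEndpointApprox D a b →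
      ∀ f ∈ F, ∃ L : ℝ,
        Tendsto (fun δ => ∫ γ, f γ.curve ∂(law D.carrier δ (a δ) (b δ))) (𝓝[>] (0 : ℝ)) (𝓝 L)) := by
  constructor
  · intro h
    obtain ⟨hT, hO⟩ := limitExists_iff_eventualTight_and_forall_tendsto_integral.1 h
    exact ⟨hT, fun D a b hab f _ => hO D a b hab f⟩
  · rintro ⟨hT, hO⟩
    refine limitExists_iff_eventualTight_and_uniqueSubseqLimits.2 ⟨hT, ?_⟩
    intro D a b a' b' hab hab' s s' ν ν' hs hs' hν hν' hlim hlim'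
    haveI := hν
    haveI := hν'
    exact eq_of_subseqLimits_of_observableLimits_on hF (hO D) hab hab' hs hs' hlim hlim'

/-- **Modulo tightness the crux is COUNTABLY many real limits.**  There is ONE countable set `F` of bounded
continuous observables of the curve class, separating finite Borel measures on `CurveClass ℂ`, such that
`LimitExists ↔ EventualTight ∧` (for every Dobrushin domain, every endpoint approximation and every `f ∈ F` the
critical expectation `E_δ[f(γ)]` converges along `δ → 0⁺`).  So the content of the crux beyond item
stmt-CriticalPhenomena-1372 is the convergence of countably many real sequences per (domain, approximation);
the compactness half (T) is exactly what no countable family of observables can supply.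
(`exists_countable_separating_integral` + `limitExists_iff_eventualTight_and_forall_mem_tendsto_integral`.)
[folklore; Billingsley CPM Thm. 2.6, Parthasarathy Thm. II.6.6] -/
theorem limitExists_iff_eventualTight_and_countable : ∃ F : Set (BoundedContinuousFunction (Literature.Probability.RandomPlanarGeometry.CurveClass ℂ) ℝ), F.Countable ∧ (∀ μ ν : MeasureTheory.Measure (Literature.Probability.RandomPlanarGeometry.CurveClass ℂ), MeasureTheory.IsFiniteMeasure μ → MeasureTheory.IsFiniteMeasure ν → (∀ f ∈ F, ∫ x, f x ∂μ = ∫ x, f x ∂ν) → μ = ν) ∧ (Summit.CriticalPhenomena.SAWScalingLimit.Theses.SAWRestrictionRigidity.LimitExists ↔ (Summit.CriticalPhenomena.SAWScalingLimit.Theses.SAWRestrictionRigidity.EventualTight ∧ ∀ (D : Literature.Probability.RandomPlanarGeometry.DobrushinDomain) (a b : ℝ → Literature.Probability.LatticeModels.Site 2), Literature.Probability.RandomPlanarGeometry.SAW.IsEndpointApprox D a b → ∀ f ∈ F, ∃ L : ℝ, Filter.Tendsto (fun δ => ∫ γ, f γ.curve ∂(Literature.Probability.RandomPlanarGeometry.SAW.law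 D.carrier δ (a δ) (b δ))) (nhdsWithin 0 (Set.Ioi 0)) (nhds L))) := by
  obtain ⟨F, hFc, hF⟩ := exists_countable_separating_integral (CurveClass ℂ)
  exact ⟨F, hFc, hF, limitExists_iff_eventualTight_and_forall_mem_tendsto_integral hF⟩

end Summit.CriticalPhenomena.SAWScalingLimit.Theorems.SAWRestrictionRigidityLimitExists

end
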